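import Summits.PneNP.PneNP.Theses.Kloosterman
import Literature.Computability.Complexity.CodeFPArith
import Literature.Computability.Complexity.RandomizedProofs
import Literature.Barriers.Parity.LinearSieveOptimalityBaseCases

/-!
# Route Kloosterman — `PlantedToWorstCase` (stmt-PneNP-2578)

Glue `X → W`: a worst-case `FP` square-root finder `g` (the negation of `SqfreeRootSearchHard`) yields the coin-free
PPT solver `RandAlg.ofDet (g ∘ d)` of the planted problem, where `d ∈ FP` re-encodes the instance
`⟨code S, ⟨bin a, bin c⟩⟩ ↦ ⟨code S, ⟨bin a, bin (c-1)⟩⟩` (the worst-case spec returns `z ≤ c`, the planted success event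
asks `z < c`; the planted `x < c` is itself a root `≤ c - 1`). Its success probability is `1` on EVERY instance, so the
planted average is `1` as soon as the prime family is non-empty — which holds for all large `m`: by the prime number
theorem in the form `#{p ∈ [2X, 4X)} log X / X → 2` (`tendsto_card_primes_Ico_mul_log_div`) there are `≥ m` primes in
`[2^{3L+2}, 2^{3L+3})`, `L = ⌊log₂ m⌋`. This contradicts the bound `≤ 1 - 1/q(m)` of `PlantedRootHardness`.
-/

set_option linter.dupNamespace false -- `Summit.PneNP.PneNP.…`: summit = sub-problem name (D-0017 single-conjunct layout)

namespace Summit.PneNP.PneNP.Theorems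

open _root_.Computability Polynomial Filter Finset
open Literature.Computability.Complexity Literature.Computability.Complexity.CodeFP
  Literature.Computability.Complexity.Brick

/-- **Enough primes of the right size, eventually**: for all large `m` the dyadic block `[2^{3L+2}, 2^{3L+3})`,
`L = ⌊log₂ m⌋`, contains at least `m` primes (PNT in the form `#{p ∈ [2X,4X)} · log X / X → 2` at `X = 2^{3L+1}`,
with `log X ≤ 2√X` and `4m² ≤ X`). [cite: Greaves2001, §4.5.1 p. 124] [folklore] -/
theorem kloosterman_eventually_le_card_primes :
    ∀ᶠ m : ℕ in atTop, m ≤ ((Ico (2 ^ (3 * Nat.log 2 m + 2)) (2 ^ (3 * Nat.log 2 m + 3))).filter Nat.Prime).card := by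
  have h := Literature.Barriers.Parity.tendsto_card_primes_Ico_mul_log_div
  have hgt : ∀ᶠ X : ℝ in atTop,
      1 < (#((Ico ⌈2 * X⌉₊ ⌈4 * X⌉₊).filter Nat.Prime) : ℝ) * Real.log X / X :=
    (tendsto_order.1 h).1 1 (by norm_num)
  -- `X(m) = 2^{3L+1} → ∞`
  have hX : Tendsto (fun m : ℕ => (2 : ℝ) ^ (3 * Nat.log 2 m + 1)) atTop atTop := by
    refine tendsto_atTop_mono (fun m => ?_) tendsto_natCast_atTop_atTop
    have h1 : m < 2 ^ (Nat.log 2 m + 1) := Nat.lt_pow_succ_log_self one_lt_two m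
    have h2 : 2 ^ (Nat.log 2 m + 1) ≤ 2 ^ (3 * Nat.log 2 m + 1) := Nat.pow_le_pow_right two_pos (by omega)
    exact_mod_cast (h1.le.trans h2)
  filter_upwards [hX.eventually hgt, eventually_ge_atTop 16] with m hm h16
  set L := Nat.log 2 m with hL
  set X : ℝ := (2 : ℝ) ^ (3 * L + 1) with hXdef
  have hXpos : 0 < X := by positivity
  have e2 : ⌈2 * X⌉₊ = 2 ^ (3 * L + 2) := by
    rw [show (2 : ℝ) * X = ((2 ^ (3 * L + 2) : ℕ) : ℝ) by rw [hXdef]; push_cast; ring, Nat.ceil_natCast]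
  have e4 : ⌈4 * X⌉₊ = 2 ^ (3 * L + 3) := by
    rw [show (4 : ℝ) * X = ((2 ^ (3 * L + 3) : ℕ) : ℝ) by rw [hXdef]; push_cast; ring, Nat.ceil_natCast]
  rw [e2, e4] at hm
  set C : ℕ := #((Ico (2 ^ (3 * L + 2)) (2 ^ (3 * L + 3))).filter Nat.Prime) with hC
  -- `X < C log X ≤ 2 C √X`
  have hlt : X < (C : ℝ) * Real.log X := by
    rw [lt_div_iff₀ hXpos, one_mul] at hm
    exact hm
  have hlog : Real.log X ≤ 2 * Real.sqrt X := by
    have := Real.log_le_rpow_div hXpos.le (by norm_num : (0 : ℝ) < 1 / 2)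
    rw [Real.sqrt_eq_rpow]
    linarith
  have hsqrt_pos : 0 < Real.sqrt X := Real.sqrt_pos.2 hXpos
  have hC1 : Real.sqrt X < 2 * C := by
    have h1 : X < (C : ℝ) * (2 * Real.sqrt X) := hlt.trans_le (by gcongr)
    have h2 : Real.sqrt X * Real.sqrt X < (2 * C) * Real.sqrt X := by
      rw [Real.mul_self_sqrt hXpos.le]; linarith
    exact lt_of_mul_lt_mul_right h2 hsqrt_pos.le
  -- `2m ≤ √X`, i.e. `4m² ≤ X`
  have hL3 : 3 ≤ L := by
    rw [hL]
    exact Nat.le_log_of_pow_le one_lt_two (by omega)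
  have hmX : (4 : ℝ) * m ^ 2 ≤ X := by
    have h1 : m < 2 ^ (L + 1) := Nat.lt_pow_succ_log_self one_lt_two m
    have h2 : 4 * m ^ 2 ≤ 2 ^ (3 * L + 1) := by
      have h3 : m * m < 2 ^ (L + 1) * 2 ^ (L + 1) := Nat.mul_lt_mul'' h1 h1
      have h4 : 2 ^ (L + 1) * 2 ^ (L + 1) * 4 = 2 ^ (2 * L + 4) := by
        rw [← pow_add, show (4 : ℕ) = 2 ^ 2 by norm_num, ← pow_add]; ring_nf
      have h5 : 2 ^ (2 * L + 4) ≤ 2 ^ (3 * L + 1) := Nat.pow_le_pow_right two_pos (by omega)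
      nlinarith
    rw [hXdef]
    exact_mod_cast h2
  have h2m : (2 : ℝ) * m ≤ Real.sqrt X := by
    have h := Real.sqrt_le_sqrt hmX
    rwa [show (4 : ℝ) * (m : ℝ) ^ 2 = (2 * m) ^ 2 by ring, Real.sqrt_sq (by positivity)] at h
  have hfin : (m : ℝ) < C := by linarith
  exact_mod_cast hfin.le

/-- The instance re-encoding `⟨s, ⟨bin a, bin c⟩⟩ ↦ ⟨s, ⟨bin a, bin (c - 1)⟩⟩` is computed on codes in polynomial time.
[cite: AroraBarak2009, §1.3] [folklore] -/
theorem kloosterman_codeFP_decr :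
    CodeFP (pairE strE (pairE natE natE)) (pairE strE (pairE natE natE))
      fun t : List Bool × (ℕ × ℕ) => (t.1, (t.2.1, t.2.2 - 1)) :=
  (CodeFP.fst _ _).pair (((CodeFP.snd _ _).fst').pair (natSub.comp (((CodeFP.snd _ _).snd').pair (CodeFP.const _ 1))))

/-- The sorted list of a finset of naturals has the finset's product. [folklore] -/
theorem kloosterman_prod_sort (S : Finset ℕ) : (S.sort (· ≤ ·)).prod = ∏ p ∈ S, p := by
  rw [← Multiset.prod_coe, Finset.sort_eq, Finset.prod_eq_multiset_prod, Multiset.map_id']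

/-- **Glue `X → W` of route Kloosterman (stmt-PneNP-2578)**: `PlantedRootHardness → SqfreeRootSearchHard`. A worst-case
`FP` root finder, run on the re-encoded instance `(S, a, c - 1)`, is a coin-free PPT solver (`RandAlg.ofDet`,
`IsPolyTime.ofDet_holds`) with success probability `1` on every planted instance; the prime family is non-empty for
all large `m` (`kloosterman_eventually_le_card_primes`), so the planted average is `1 > 1 - 1/q(m)`.
[cite: Goldreich2001, §2.7.4] [cite: AroraBarak2009, §7.1] -/
theorem kloosterman_plantedToWorstCase_proof : Summit.PneNP.PneNP.Theses.Kloosterman.PlantedToWorstCase := by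
  classical
  intro hX hex
  obtain ⟨g, hg, hspec⟩ := hex
  obtain ⟨q, hqpos, hB⟩ := hX
  obtain ⟨d, hd, hdspec⟩ := kloosterman_codeFP_decr
  have hg' : (g ∘ d) ∈ FP := comp_mem_FP hg hd
  have hpoly : (RandAlg.ofDet (g ∘ d)).IsPolyTime (id : List Bool → List Bool) (id : List Bool → List Bool) :=
    RandAlg.IsPolyTime.ofDet_holds hg'
  have hev := hB (RandAlg.ofDet (g ∘ d)) hpoly
  obtain ⟨m, hm, hcard⟩ := (hev.and kloosterman_eventually_le_card_primes).exists
  revert hm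
  rw [imp_false, not_le]
  set fam := powersetCard m ((Ico (2 ^ (3 * Nat.log 2 m + 2)) (2 ^ (3 * Nat.log 2 m + 3))).filter Nat.Prime)
    with hfamdef
  -- the prime family is non-empty
  have hfam : fam.Nonempty := Finset.powersetCard_nonempty.2 hcard
  -- every planted instance is solved with probability one
  have hinner : ∀ S ∈ fam,
      (∑ x ∈ Finset.range ((∏ p ∈ S, p) / 2 ^ m),
          (RandAlg.ofDet (g ∘ d)).pr id
            (boolPair (encodingListNatBool.encode (S.sort (· ≤ ·)))
              (boolPair (encodeNat (x ^ 2 % ∏ p ∈ S, p)) (encodeNat ((∏ p ∈ S, p) / 2 ^ m))))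
            {w | decodeNat w < (∏ p ∈ S, p) / 2 ^ m ∧ decodeNat w ^ 2 ≡ x ^ 2 [MOD ∏ p ∈ S, p]}) /
        ((((∏ p ∈ S, p) / 2 ^ m : ℕ)) : ℝ) = 1 := by
    intro S hS
    obtain ⟨hSsub, hScard⟩ := Finset.mem_powersetCard.1 hS
    set N := ∏ p ∈ S, p with hN
    set c := N / 2 ^ m with hc
    have hprime : ∀ p ∈ S.sort (· ≤ ·), p.Prime := fun p hp =>
      (Finset.mem_filter.1 (hSsub ((Finset.mem_sort _).1 hp))).2
    have hsorted : (S.sort (· ≤ ·)).Pairwise (· < ·) :=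
      List.sortedLT_iff_pairwise.1 (Finset.sortedLT_sort S)
    have hNge : 2 ^ m ≤ N := by
      rw [hN, ← hScard]
      exact Finset.pow_card_le_prod S (fun p => p) 2 fun p hp => (Finset.mem_filter.1 (hSsub hp)).2.two_le
    have hcpos : 0 < c := Nat.div_pos hNge (by positivity)
    have hpr : ∀ x ∈ Finset.range c,
        (RandAlg.ofDet (g ∘ d)).pr id
            (boolPair (encodingListNatBool.encode (S.sort (· ≤ ·)))
              (boolPair (encodeNat (x ^ 2 % N)) (encodeNat c)))
            {w | decodeNat w < c ∧ decodeNat w ^ 2 ≡ x ^ 2 [MOD N]} = 1 := by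
      intro x hx
      rw [Finset.mem_range] at hx
      rw [RandAlg.pr_ofDet, if_pos]
      -- the output of the worst-case solver on the re-encoded instance
      have hdx : d (boolPair (encodingListNatBool.encode (S.sort (· ≤ ·)))
            (boolPair (encodeNat (x ^ 2 % N)) (encodeNat c))) =
          boolPair (encodingListNatBool.encode (S.sort (· ≤ ·)))
            (boolPair (encodeNat (x ^ 2 % N)) (encodeNat (c - 1))) :=
        hdspec (encodingListNatBool.encode (S.sort (· ≤ ·)), (x ^ 2 % N, c))
      have hsol := hspec (S.sort (· ≤ ·)) (x ^ 2 % N) (c - 1) hsorted hprime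
        ⟨x, by omega, by rw [kloosterman_prod_sort]; exact (Nat.mod_modEq _ _).symm⟩
      rw [kloosterman_prod_sort] at hsol
      refine ⟨?_, ?_⟩
      · show decodeNat ((g ∘ d) _) < c
        rw [Function.comp_apply, hdx]
        omega
      · show decodeNat ((g ∘ d) _) ^ 2 ≡ x ^ 2 [MOD N]
        rw [Function.comp_apply, hdx]
        exact hsol.2.trans (Nat.mod_modEq _ _)
    rw [Finset.sum_congr rfl hpr, Finset.sum_const, Finset.card_range, nsmul_eq_mul, mul_one]
    exact div_self (by exact_mod_cast hcpos.ne')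
  rw [Finset.sum_congr rfl hinner, Finset.sum_const, nsmul_eq_mul, mul_one,
    div_self (by exact_mod_cast hfam.card_pos.ne')]
  have hq : (0 : ℝ) < 1 / ((q.eval m : ℕ) : ℝ) := by
    have := hqpos m
    positivity
  linarith

end Summit.PneNP.PneNP.Theorems
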